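import Mathlib
import HarnessLib
import Summits.HubbardSuperconductivity.HubbardSuperconductivity.Theorems.KLProgrammeKLRegimeTorusCubicDyadic

/-!
# Route `KLProgramme` — engine support (route (L2), ADDITIVE weight): the inverse of the additive quartic weight is summable on the
# space-time torus `(ℤ/Pℤ)¹ × (ℤ/Lℤ)²`, uniformly in `(P, L)` — `Σ_{(j,z)} (1 + Σ_{5 directions} (s·a)⁴)⁻¹ ≤ C·s₀⁻¹·(s₂|v|)⁻¹·(s₃|v|)⁻¹ + far term`

Cell `gate-hubbard-kl`, seat hubbard-kl-k3c2-p3 (row «sector-counting import (DR2000 L11/L12) for the leg-dress bar»), for the ENGINE child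
stmt-HubbardSuperconductivity-19823 (`stub_engine_step_norms`: the propagator constant `α_n` = row/column `ℓ¹` sums of the sectorised slice covariance,
and the sector-multiplier overlap size `B` of HOME/prover-p4/FRAME-L22-NOTE.md §2).

The `ℓ²` route to the `ℓ¹` norm of a space-time lattice kernel `g(z) = Σ_p χ_p(z) Ĝ(p)` (Literature
`TorusFourierWeightedL1Prod.sum_sum_norm_prodChar_le`, Benfatto–Giuliani–Mastropietro 2006 Lemma 2.2 at finite `(β, L)`) is Cauchy–Schwarz with a
weight `W`: `Σ_z ‖g‖ ≤ √(Σ_z W‖g‖²)·√(Σ_z W⁻¹)`.  With the ADDITIVE weight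
`W(j,z) = 1 + Σ_v c_v ‖χ_v(z) − 1‖⁴` over five directions `v` — time, the two lattice axes, and the integer frame `(v⊥, v)` of an anisotropic
sector — the Plancherel partner `Σ_z W‖g‖²` costs only the SINGLE-direction second differences `Σ_v c_v Σ_p ‖Δ_v² Ĝ(p)‖²` of the symbol (no
mixed differences), so on an admissible frame only `C²` data of the band enter (`FrameOK` (i)).  What this file supplies is the other factor:
writing the five decay variables as `X = s₀|j̃|`, `I₁ = s₁|z̃₁|`, `I₂ = s₁|z̃₂|`, `Y = s₂|ã_{v⊥}(z)|`, `Z = s₃|ã_v(z)|`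
(`ã_w(z) = valMinAbs (w₁z₁ + w₂z₂)`, the tree's currency of `AnisotropicTorusSum`),

  **`sum_inv_additiveQuarticWeight_le`**: `Σ_{(j,z)} (1 + X⁴ + I₁⁴ + I₂⁴ + Y⁴ + Z⁴)⁻¹
      ≤ 2048·(1/s₀ + 1)·[4·(2√2/(s₂|v|) + 2)(2√2/(s₃|v|) + 2) + 16·(1/s₁ + 1)²/(1 + s₁R₀)]`

for every near radius `R₀` with `2(|v₁|+|v₂|)R₀ < L` — the `s₀⁻¹(s₂|v|)⁻¹(s₃|v|)⁻¹` volume of the dual cell (three quartic decay variables in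
`2+1` lattice dimensions: `Σ 1/(1 + X⁴ + Y⁴ + Z⁴) ≍ ∫d³u/(1 + |u|⁴) < ∞`) plus a far-region term through the isotropic variables.  Method: a
DYADIC LAYER CAKE with a CUBIC count (`KLProgrammeKLRegimeTorusCubicDyadic.sum_inv_pow_le_of_card_le_cubic`: `#{f ≤ R} ≤ A·R³` and `f ≥ R_min ≥ 1` give
`Σ f⁻⁴ ≤ 32A/R_min`), the power-mean step `(1 + X + Y + Z)⁴ ≤ 64(1 + X⁴ + Y⁴ + Z⁴)` (`inv_one_add_quartic_le`), the near-region frame count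
`card_filter_frame_near_le` and the isotropic count `AnisotropicTorusSum.card_filter_torus_l1_le` for the far region (where `f ≥ 1 + s₁R₀`).  No fractional powers.
Everything is proved; no definitions, no named facts. [folklore]

References: G. Benfatto, A. Giuliani, V. Mastropietro, Ann. Henri Poincaré 7 (2006) 809–898, §2.6 (2.81), Lemma 2.2 and footnote ¹; M. Disertori,
V. Rivasseau, Comm. Math. Phys. 215 (2000) 251–290, §IV.2 Lemma 4 / App. A Lemma 12 (the sector `L¹` norm this volume factor serves).
-/

noncomputable section

namespace Summit.HubbardSuperconductivity.HubbardSuperconductivity.Theorems.TorusFourierL2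

set_option linter.dupNamespace false -- summit = problem name (single-conjunct summit), D-0017

open Finset Literature.Probability.LatticeModels
open scoped Real

/-! ### The inverse additive quartic weight is summable, uniformly in `(P, L)` -/

/-- **The inverse of the ADDITIVE quartic weight is summable on the space-time torus, uniformly in `(P, L)`.**  For rates
`s₀, s₁, s₂, s₃ > 0`, an integer direction `v ≠ 0` (frame `(v⊥, v)`, `|v| = √(v₁² + v₂²)`) and a near radius `R₀` with `2(|v₁|+|v₂|)R₀ < L`:
`Σ_{(j,z)} (1 + (s₀|j̃|)⁴ + (s₁|z̃₁|)⁴ + (s₁|z̃₂|)⁴ + (s₂|ã_{v⊥}(z)|)⁴ + (s₃|ã_v(z)|)⁴)⁻¹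
  ≤ 2048·(1/s₀ + 1)·[4·(2√2/(s₂|v|) + 2)(2√2/(s₃|v|) + 2) + 16·(1/s₁ + 1)²/(1 + s₁R₀)]`
(`ã_w(z) = valMinAbs (w₁z₁ + w₂z₂)`) — the `s₀⁻¹·(s₂|v|)⁻¹·(s₃|v|)⁻¹` volume of the dual cell plus a far-region term that is small for `L` large.
Near points (`|z̃|_∞ ≤ R₀`, where `ã_w(z) = w·z̃`) are summed by dyadic shells in the three variables time/normal/tangent; far points through
the isotropic variables, where the weight is at least `1 + s₁R₀`.  This is the `Σ W⁻¹` factor of the `ℓ²` route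
`TorusFourierWeightedL1Prod.sum_sum_norm_prodChar_le` with the additive order-two weight (`c_w (4|ã_w|/L)⁴ = (s_w|ã_w|)⁴` for `c_w = (s_w L/4)⁴`).
[cite: BenfattoGiulianiMastropietro2006, §2.6 (2.81) and footnote 1] -/
theorem sum_inv_additiveQuarticWeight_le {P L : ℕ} [NeZero P] [NeZero L] (v : Fin 2 → ℤ) (hv : v ≠ 0) {s₀ s₁ s₂ s₃ : ℝ}
    (hs₀ : 0 < s₀) (hs₁ : 0 < s₁) (hs₂ : 0 < s₂) (hs₃ : 0 < s₃) {R₀ : ℕ} (hR₀ : 2 * (|v 0| + |v 1|) * (R₀ : ℤ) < L) :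
    ∑ q : TorusSite 1 P × TorusSite 2 L,
      (1 + (s₀ * |(((q.1 0).valMinAbs : ℤ) : ℝ)|) ^ 4 + (s₁ * |(((q.2 0).valMinAbs : ℤ) : ℝ)|) ^ 4 +
        (s₁ * |(((q.2 1).valMinAbs : ℤ) : ℝ)|) ^ 4 +
        (s₂ * |(((∑ j, ((![-v 1, v 0] j : ℤ) : ZMod L) * q.2 j).valMinAbs : ℤ) : ℝ)|) ^ 4 +
        (s₃ * |(((∑ j, ((v j : ℤ) : ZMod L) * q.2 j).valMinAbs : ℤ) : ℝ)|) ^ 4)⁻¹ ≤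
      2048 * (1 / s₀ + 1) *
        (4 * ((2 * Real.sqrt 2 / (s₂ * Real.sqrt ((v 0 : ℝ) ^ 2 + (v 1 : ℝ) ^ 2)) + 2) *
            (2 * Real.sqrt 2 / (s₃ * Real.sqrt ((v 0 : ℝ) ^ 2 + (v 1 : ℝ) ^ 2)) + 2))
          + 16 * (1 / s₁ + 1) ^ 2 / (1 + s₁ * R₀)) := by
  classical
  -- the five decay variables
  set X : TorusSite 1 P × TorusSite 2 L → ℝ := fun q => s₀ * |(((q.1 0).valMinAbs : ℤ) : ℝ)| with hX
  set I₁ : TorusSite 1 P × TorusSite 2 L → ℝ := fun q => s₁ * |(((q.2 0).valMinAbs : ℤ) : ℝ)| with hI₁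
  set I₂ : TorusSite 1 P × TorusSite 2 L → ℝ := fun q => s₁ * |(((q.2 1).valMinAbs : ℤ) : ℝ)| with hI₂
  set Y : TorusSite 1 P × TorusSite 2 L → ℝ := fun q =>
    s₂ * |(((∑ j, ((![-v 1, v 0] j : ℤ) : ZMod L) * q.2 j).valMinAbs : ℤ) : ℝ)| with hY
  set Z : TorusSite 1 P × TorusSite 2 L → ℝ := fun q =>
    s₃ * |(((∑ j, ((v j : ℤ) : ZMod L) * q.2 j).valMinAbs : ℤ) : ℝ)| with hZ
  have hX0 : ∀ q, 0 ≤ X q := fun q => by positivity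
  have hI₁0 : ∀ q, 0 ≤ I₁ q := fun q => by positivity
  have hI₂0 : ∀ q, 0 ≤ I₂ q := fun q => by positivity
  have hY0 : ∀ q, 0 ≤ Y q := fun q => by positivity
  have hZ0 : ∀ q, 0 ≤ Z q := fun q => by positivity
  -- near / far
  let near : TorusSite 1 P × TorusSite 2 L → Prop := fun q => ∀ i, |((q.2 i).valMinAbs : ℤ)| ≤ R₀
  set Sn := (univ : Finset (TorusSite 1 P × TorusSite 2 L)).filter (fun q => near q) with hSn
  set Sf := (univ : Finset (TorusSite 1 P × TorusSite 2 L)).filter (fun q => ¬ near q) with hSf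
  set fn : TorusSite 1 P × TorusSite 2 L → ℝ := fun q => 1 + X q + Y q + Z q with hfn
  set ff : TorusSite 1 P × TorusSite 2 L → ℝ := fun q => 1 + X q + I₁ q + I₂ q with hff
  -- constants
  set r : ℝ := Real.sqrt ((v 0 : ℝ) ^ 2 + (v 1 : ℝ) ^ 2) with hr
  set An : ℝ := 4 * (1 / s₀ + 1) * ((2 * Real.sqrt 2 / (s₂ * r) + 2) * (2 * Real.sqrt 2 / (s₃ * r) + 2)) with hAn
  set Af : ℝ := 4 * (1 / s₀ + 1) * (4 * (1 / s₁ + 1) ^ 2) with hAf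
  have hAn0 : 0 ≤ An := by positivity
  have hAf0 : 0 ≤ Af := by positivity
  -- (1) pointwise reductions
  have hnear_pt : ∀ q, (1 + X q ^ 4 + I₁ q ^ 4 + I₂ q ^ 4 + Y q ^ 4 + Z q ^ 4)⁻¹ ≤ 64 * (fn q)⁻¹ ^ 4 := fun q => by
    have h1 : (1 + X q ^ 4 + I₁ q ^ 4 + I₂ q ^ 4 + Y q ^ 4 + Z q ^ 4)⁻¹ ≤ (1 + X q ^ 4 + Y q ^ 4 + Z q ^ 4)⁻¹ :=
      inv_anti₀ (by positivity) (by nlinarith [pow_nonneg (hI₁0 q) 4, pow_nonneg (hI₂0 q) 4])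
    exact h1.trans (inv_one_add_quartic_le (hX0 q) (hY0 q) (hZ0 q))
  have hfar_pt : ∀ q, (1 + X q ^ 4 + I₁ q ^ 4 + I₂ q ^ 4 + Y q ^ 4 + Z q ^ 4)⁻¹ ≤ 64 * (ff q)⁻¹ ^ 4 := fun q => by
    have h1 : (1 + X q ^ 4 + I₁ q ^ 4 + I₂ q ^ 4 + Y q ^ 4 + Z q ^ 4)⁻¹ ≤ (1 + X q ^ 4 + I₁ q ^ 4 + I₂ q ^ 4)⁻¹ :=
      inv_anti₀ (by positivity) (by nlinarith [pow_nonneg (hY0 q) 4, pow_nonneg (hZ0 q) 4])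
    exact h1.trans (inv_one_add_quartic_le (hX0 q) (hI₁0 q) (hI₂0 q))
  -- (2) the near count: `#{q ∈ Sn : fn q ≤ R} ≤ An·R³`
  have hcount_near : ∀ R : ℝ, 1 ≤ R → (((Sn.filter fun q => fn q ≤ R).card : ℕ) : ℝ) ≤ An * R ^ 3 := by
    intro R hR
    have hsub : (Sn.filter fun q => fn q ≤ R) ⊆ univ.filter (fun q : TorusSite 1 P × TorusSite 2 L =>
        s₀ * |(((q.1 0).valMinAbs : ℤ) : ℝ)| ≤ R ∧
        (s₂ * |(-(v 1 : ℝ)) * (((q.2 0).valMinAbs : ℤ) : ℝ) + (v 0 : ℝ) * (((q.2 1).valMinAbs : ℤ) : ℝ)| ≤ R ∧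
          s₃ * |(v 0 : ℝ) * (((q.2 0).valMinAbs : ℤ) : ℝ) + (v 1 : ℝ) * (((q.2 1).valMinAbs : ℤ) : ℝ)| ≤ R)) := by
      intro q hq
      rw [mem_filter] at hq
      have hqn : near q := (mem_filter.1 hq.1).2
      have hle : fn q ≤ R := hq.2
      obtain ⟨e1, e2⟩ := valMinAbs_frame_eq_of_near v hR₀ q.2 hqn
      refine mem_filter.2 ⟨mem_univ _, ?_, ?_, ?_⟩
      · have : X q ≤ R := by simp only [hfn] at hle; linarith [hY0 q, hZ0 q]
        simpa [hX] using this
      · have : Y q ≤ R := by simp only [hfn] at hle; linarith [hX0 q, hZ0 q]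
        rw [hY] at this; dsimp only at this; rwa [e1] at this
      · have : Z q ≤ R := by simp only [hfn] at hle; linarith [hX0 q, hY0 q]
        rw [hZ] at this; dsimp only at this; rwa [e2] at this
    have hprod := card_filter_prod_and_le (fun j : TorusSite 1 P => s₀ * |(((j 0).valMinAbs : ℤ) : ℝ)| ≤ R)
      (fun z : TorusSite 2 L => s₂ * |(-(v 1 : ℝ)) * (((z 0).valMinAbs : ℤ) : ℝ) + (v 0 : ℝ) * (((z 1).valMinAbs : ℤ) : ℝ)| ≤ R ∧
          s₃ * |(v 0 : ℝ) * (((z 0).valMinAbs : ℤ) : ℝ) + (v 1 : ℝ) * (((z 1).valMinAbs : ℤ) : ℝ)| ≤ R)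
      (fun q : TorusSite 1 P × TorusSite 2 L =>
        s₀ * |(((q.1 0).valMinAbs : ℤ) : ℝ)| ≤ R ∧
        (s₂ * |(-(v 1 : ℝ)) * (((q.2 0).valMinAbs : ℤ) : ℝ) + (v 0 : ℝ) * (((q.2 1).valMinAbs : ℤ) : ℝ)| ≤ R ∧
          s₃ * |(v 0 : ℝ) * (((q.2 0).valMinAbs : ℤ) : ℝ) + (v 1 : ℝ) * (((q.2 1).valMinAbs : ℤ) : ℝ)| ≤ R))
      (fun q h => h)
    have h1 := card_filter_time_le (P := P) hs₀ hR
    have h2 := card_filter_frame_near_le (L := L) v hv hs₂ hs₃ hR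
    calc (((Sn.filter fun q => fn q ≤ R).card : ℕ) : ℝ)
        ≤ ((univ.filter (fun j : TorusSite 1 P => s₀ * |(((j 0).valMinAbs : ℤ) : ℝ)| ≤ R)).card : ℝ) *
          ((univ.filter (fun z : TorusSite 2 L =>
            s₂ * |(-(v 1 : ℝ)) * (((z 0).valMinAbs : ℤ) : ℝ) + (v 0 : ℝ) * (((z 1).valMinAbs : ℤ) : ℝ)| ≤ R ∧
            s₃ * |(v 0 : ℝ) * (((z 0).valMinAbs : ℤ) : ℝ) + (v 1 : ℝ) * (((z 1).valMinAbs : ℤ) : ℝ)| ≤ R)).card : ℝ) := by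
          exact_mod_cast (card_le_card hsub).trans hprod
      _ ≤ (4 * (1 / s₀ + 1) * R) * (((2 * Real.sqrt 2 / (s₂ * r) + 2) * (2 * Real.sqrt 2 / (s₃ * r) + 2)) * R ^ 2) :=
          mul_le_mul h1 h2 (by positivity) (by positivity)
      _ = An * R ^ 3 := by rw [hAn]; ring
  -- (3) the far count: `#{q ∈ Sf : ff q ≤ R} ≤ Af·R³`, and `ff ≥ 1 + s₁R₀` on `Sf`
  have hcount_far : ∀ R : ℝ, 1 ≤ R → (((Sf.filter fun q => ff q ≤ R).card : ℕ) : ℝ) ≤ Af * R ^ 3 := by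
    intro R hR
    have hsub : (Sf.filter fun q => ff q ≤ R) ⊆ univ.filter (fun q : TorusSite 1 P × TorusSite 2 L =>
        s₀ * |(((q.1 0).valMinAbs : ℤ) : ℝ)| ≤ R ∧
        1 + s₁ * (|(((q.2 0).valMinAbs : ℤ) : ℝ)| + |(((q.2 1).valMinAbs : ℤ) : ℝ)|) ≤ R) := by
      intro q hq
      rw [mem_filter] at hq
      have hle : ff q ≤ R := hq.2
      refine mem_filter.2 ⟨mem_univ _, ?_, ?_⟩
      · have : X q ≤ R := by simp only [hff] at hle; linarith [hI₁0 q, hI₂0 q]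
        simpa [hX] using this
      · have : 1 + I₁ q + I₂ q ≤ R := by simp only [hff] at hle; linarith [hX0 q]
        simp only [hI₁, hI₂] at this; linarith
    have hprod := card_filter_prod_and_le (fun j : TorusSite 1 P => s₀ * |(((j 0).valMinAbs : ℤ) : ℝ)| ≤ R)
      (fun z : TorusSite 2 L => 1 + s₁ * (|(((z 0).valMinAbs : ℤ) : ℝ)| + |(((z 1).valMinAbs : ℤ) : ℝ)|) ≤ R)
      (fun q : TorusSite 1 P × TorusSite 2 L =>
        s₀ * |(((q.1 0).valMinAbs : ℤ) : ℝ)| ≤ R ∧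
        1 + s₁ * (|(((q.2 0).valMinAbs : ℤ) : ℝ)| + |(((q.2 1).valMinAbs : ℤ) : ℝ)|) ≤ R)
      (fun q h => h)
    have h1 := card_filter_time_le (P := P) hs₀ hR
    have h2 := card_filter_torus_l1_le (L := L) hs₁ hR
    calc (((Sf.filter fun q => ff q ≤ R).card : ℕ) : ℝ)
        ≤ ((univ.filter (fun j : TorusSite 1 P => s₀ * |(((j 0).valMinAbs : ℤ) : ℝ)| ≤ R)).card : ℝ) *
          ((univ.filter (fun z : TorusSite 2 L =>
            1 + s₁ * (|(((z 0).valMinAbs : ℤ) : ℝ)| + |(((z 1).valMinAbs : ℤ) : ℝ)|) ≤ R)).card : ℝ) := by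
          exact_mod_cast (card_le_card hsub).trans hprod
      _ ≤ (4 * (1 / s₀ + 1) * R) * (4 * (1 / s₁ + 1) ^ 2 * R ^ 2) := mul_le_mul h1 h2 (by positivity) (by positivity)
      _ = Af * R ^ 3 := by rw [hAf]; ring
  have hfar_min : ∀ q ∈ Sf, 1 + s₁ * R₀ ≤ ff q := by
    intro q hq
    have hq' : ¬ near q := (mem_filter.1 hq).2
    simp only [near, not_forall, not_le] at hq'
    obtain ⟨i, hi⟩ := hq'
    have hi' : (R₀ : ℝ) ≤ |(((q.2 i).valMinAbs : ℤ) : ℝ)| := by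
      rw [← Int.cast_abs]; exact_mod_cast hi.le
    have hsum : |(((q.2 i).valMinAbs : ℤ) : ℝ)| ≤ |(((q.2 0).valMinAbs : ℤ) : ℝ)| + |(((q.2 1).valMinAbs : ℤ) : ℝ)| := by
      have h := Finset.single_le_sum (f := fun i : Fin 2 => |(((q.2 i).valMinAbs : ℤ) : ℝ)|) (fun j _ => abs_nonneg _)
        (mem_univ i)
      rwa [Fin.sum_univ_two] at h
    have : s₁ * R₀ ≤ I₁ q + I₂ q := by
      simp only [hI₁, hI₂]; rw [← mul_add]; exact mul_le_mul_of_nonneg_left (hi'.trans hsum) hs₁.le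
    simp only [hff]; linarith [hX0 q]
  -- (4) the two dyadic sums
  have hnear_sum : ∑ q ∈ Sn, (fn q)⁻¹ ^ 4 ≤ 32 * An / 1 :=
    sum_inv_pow_le_of_card_le_cubic Sn fn le_rfl (fun q _ => by simp only [hfn]; linarith [hX0 q, hY0 q, hZ0 q]) hAn0
      hcount_near le_rfl
  have hRmin : (1 : ℝ) ≤ 1 + s₁ * R₀ := le_add_of_nonneg_right (by positivity)
  have hfar_sum : ∑ q ∈ Sf, (ff q)⁻¹ ^ 4 ≤ 32 * Af / (1 + s₁ * R₀) :=
    sum_inv_pow_le_of_card_le_cubic Sf ff hRmin hfar_min hAf0 hcount_far le_rfl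
  -- (5) assemble
  have hsplit := (sum_filter_add_sum_filter_not univ near
    (fun q : TorusSite 1 P × TorusSite 2 L => (1 + X q ^ 4 + I₁ q ^ 4 + I₂ q ^ 4 + Y q ^ 4 + Z q ^ 4)⁻¹)).symm
  calc ∑ q : TorusSite 1 P × TorusSite 2 L, (1 + X q ^ 4 + I₁ q ^ 4 + I₂ q ^ 4 + Y q ^ 4 + Z q ^ 4)⁻¹
      = ∑ q ∈ Sn, (1 + X q ^ 4 + I₁ q ^ 4 + I₂ q ^ 4 + Y q ^ 4 + Z q ^ 4)⁻¹ +
          ∑ q ∈ Sf, (1 + X q ^ 4 + I₁ q ^ 4 + I₂ q ^ 4 + Y q ^ 4 + Z q ^ 4)⁻¹ := hsplit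
    _ ≤ ∑ q ∈ Sn, 64 * (fn q)⁻¹ ^ 4 + ∑ q ∈ Sf, 64 * (ff q)⁻¹ ^ 4 :=
        add_le_add (sum_le_sum fun q _ => hnear_pt q) (sum_le_sum fun q _ => hfar_pt q)
    _ = 64 * ∑ q ∈ Sn, (fn q)⁻¹ ^ 4 + 64 * ∑ q ∈ Sf, (ff q)⁻¹ ^ 4 := by rw [mul_sum, mul_sum]
    _ ≤ 64 * (32 * An / 1) + 64 * (32 * Af / (1 + s₁ * R₀)) := by gcongr
    _ = 2048 * (1 / s₀ + 1) * (4 * ((2 * Real.sqrt 2 / (s₂ * r) + 2) * (2 * Real.sqrt 2 / (s₃ * r) + 2))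
          + 16 * (1 / s₁ + 1) ^ 2 / (1 + s₁ * R₀)) := by
        rw [hAn, hAf]
        have hden : (1 + s₁ * (R₀ : ℝ)) ≠ 0 := by positivity
        field_simp
        ring

end Summit.HubbardSuperconductivity.HubbardSuperconductivity.Theorems.TorusFourierL2

end
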